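import Summits.AnomalousDissipation.AnomalousDissipation.Theorems.IsotropicCubatureWord

/-!
# K2Q first rung `stub_isotropicDesign` (route `AnomalousDissipation/SolenoidalFractalHomogenisation`)

Crux `QuasiStaticSolenoidalCellTensorQ` (stmt-AnomalousDissipation-19072), registered BC3 skeleton stub
`stub_isotropicDesign : ∃ k, ∃ W : LatticeShear.LatticeWord k, ∃ c₀ > 0, LatticeShear.IsotropicWordGain W c₀`, by name
and signature — the witness is the 26-slot degree-7 cubature word of `Theorems/IsotropicCubatureWord.lean`
(`isotropicDesign_exists`, cell `ad-ideate` seat ad-p1, ROUND-2 Lemma 1.3; `c₀ = 7/(4960 π⁴)`).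
-/

-- `Summit.<Summit>.<Problem>` is the tree's mandated summit-side namespace (CONVENTIONS §2); for this
-- single-conjunct summit the two coincide, so the duplicate is deliberate (lakefile: off for `Summits`).
set_option linter.dupNamespace false

namespace Summit.AnomalousDissipation.AnomalousDissipation.Theorems

open Literature.Analysis Literature.Analysis.FluidPDE

/-- **Registered stub `stub_isotropicDesign` of crux K2Q** (stmt-AnomalousDissipation-19072): there is a lattice word with
an exactly isotropic positive Taylor gain — the cubature word, `isotropicDesign_exists`. -/
theorem stub_isotropicDesign :
    ∃ k, ∃ W : LatticeShear.LatticeWord k, ∃ c₀ > (0:ℝ), LatticeShear.IsotropicWordGain W c₀ :=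
  isotropicDesign_exists

end Summit.AnomalousDissipation.AnomalousDissipation.Theorems
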